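import Literature.Analysis.FluidPDE.KNSSLiouville
import Literature.Analysis.FluidPDE.IsometryInvariance
import Literature.Analysis.FluidPDE.ClassicalSolutionCalculus
import HarnessLib

/-!
# Isometry invariance of bounded weak Navier–Stokes solutions (KNSS 2009, §4 (ii))

Analysis/FluidPDE support file (everything proved; no definitions, no named facts). The class of
bounded weak solutions of Koch–Nadirashvili–Seregin–Šverák (`IsBoundedWeakNSSolutionOn`,
`KNSSLiouville`; Acta Math. 203 (2009) = arXiv:0709.3599, §4 (ii), p. 8: `u ∈ L^∞`, `div u = 0`
in distributions, `∫∫ u·(φₜ + Δφ) + u_k u·∂_k φ = 0` for all smooth compactly supported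
divergence-free `φ`) is invariant under time translations
(`IsBoundedWeakNSSolutionOn.comp_add_right`, `KNSSRegularityGluing`) and space translations
(`IsBoundedWeakNSSolutionOn.comp_add_space`, `BoundedWeakTranslate`). This file proves its
invariance under the remaining Euclidean motions, the **linear isometries** `R` of the space,
`u ↦ R u(t, R⁻¹ ·)` (Majda–Bertozzi 2002, §1.2, Prop. 1.1 (iii), rotation symmetry
`v_Q(x, t) = Qᵗ v(Qx, t)`, there for classical solutions — the tree's
`IsClassicalNSSolutionOn.conj_linearIsometryEquiv`, `IsometryInvariance` — here for KNSS's weak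
class):

* `IsWeaklyDivFree.conj_linearIsometryEquiv` — the distributional divergence constraint is
  invariant (test `θ ∘ R`, `∇(θ ∘ R) = R⁻¹ (∇θ) ∘ R`);
* `IsSpaceTimeTestOn.comp_linearIsometryEquiv` — `(t, y) ↦ L ψ(t, R y)` is a space–time test
  field on the slab `I × E` when `ψ` is;
* `IsBoundedWeakNSSolutionOn.conj_linearIsometryEquiv` — the invariance of the class:
  measurability and the bound move along the measure-preserving `(t, y) ↦ (t, R⁻¹ y)`, and a
  divergence-free test field `ψ` is tested against `R u R⁻¹` by testing `R⁻¹ ψ(t, R ·)` against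
  `u`, the three pairings matching point by point (`convect_conj_linearIsometryEquiv`,
  `laplacian_conj_linearIsometryEquiv`, `IsometryInvariance`) under the `R`-invariant space
  integral.

Typical use: transporting statements made about one coordinate axis or plane (axisymmetry about
`e_z`, invariance along `e_z`, the planar lift/descent of `PlanarLiftWeak`) to another axis, e.g.
by the coordinate swap `LinearIsometryEquiv.piLpCongrLeft 2 ℝ ℝ (Equiv.swap 1 2)` of `ℝ³`.

## Mathlib / tree search

Tree: `IsBoundedWeakNSSolutionOn` (`KNSSLiouville`), the models `comp_add_right` /
`comp_add_space` (`KNSSRegularityGluing`, `BoundedWeakTranslate`), the pointwise covariance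
lemmas `gradient_comp_linearIsometryEquiv_symm`, `convect_conj_linearIsometryEquiv`,
`laplacian_conj_linearIsometryEquiv`, `VectorCalculus.IsDivFree.conj_linearIsometryEquiv`
(`IsometryInvariance`); no prior weak-class statement (`lean search
'IsBoundedWeakNSSolutionOn.*[Ii]sometry|conj_linearIsometryEquiv'`: classical solutions only).
Mathlib: `LinearIsometryEquiv.measurePreserving`, `MeasurePreserving.integral_comp`,
`MeasurePreserving.restrict_preimage`, `HasCompactSupport.comp_homeomorph`,
`tsupport_comp_eq_preimage`, `LinearIsometryEquiv.inner_map_eq_flip`.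

## References

* G. Koch, N. Nadirashvili, G. Seregin, V. Šverák, *Liouville theorems for the Navier–Stokes
  equations and applications*, Acta Math. 203 (2009) 83–105 = arXiv:0709.3599, §4 (ii), p. 8;
  §1 and §5 (axisymmetry: "`u(Rx) = Ru(x)` for every rotation `R`", p. 9).
  [KochNadirashviliSereginSverak2009]
* A. J. Majda, A. L. Bertozzi, *Vorticity and Incompressible Flow*, CUP 2002, §1.2,
  Prop. 1.1 (iii). [MajdaBertozziCUP2002]
-/

noncomputable section

open MeasureTheory Set Function Filter Topology TopologicalSpace Metric
open scoped RealInnerProductSpace ContDiff Laplacian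

namespace Literature.Analysis.FluidPDE

section Isometry

variable {E : Type*} [NormedAddCommGroup E] [InnerProductSpace ℝ E] [FiniteDimensional ℝ E]
  [MeasurableSpace E] [BorelSpace E]

/-- **Weak divergence-freeness is invariant under conjugation by a linear isometry**: if
`∫ ⟪v, ∇θ⟫ = 0` for all test functions `θ`, then the same holds for `y ↦ R (v (R⁻¹ y))`
(substitute `y = R x` and test against `θ ∘ R`: `⟪R v, ∇θ (R x)⟫ = ⟪v, ∇(θ ∘ R)(x)⟫). [folklore] -/
theorem IsWeaklyDivFree.conj_linearIsometryEquiv (R : E ≃ₗᵢ[ℝ] E) {v : E → E}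
    (hv : IsWeaklyDivFree v) : IsWeaklyDivFree (fun y => R (v (R.symm y))) := by
  intro θ hθ
  have hR : MeasurePreserving (R : E → E) volume volume := R.measurePreserving
  have h1 : ∫ y, ⟪R (v (R.symm y)), gradient θ y⟫ = ∫ x, ⟪R (v x), gradient θ (R x)⟫ := by
    rw [← hR.integral_comp R.toHomeomorph.measurableEmbedding]
    simp
  rw [h1]
  have hθ' : FunctionSpaces.IsTestFunctionOn (⊤ : Opens E) (θ ∘ ⇑R.toContinuousLinearEquiv) :=
    ⟨hθ.contDiff.comp R.toContinuousLinearEquiv.contDiff,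
      hθ.hasCompactSupport.comp_homeomorph R.toContinuousLinearEquiv.toHomeomorph, by simp⟩
  have h2 : ∀ x, ⟪R (v x), gradient θ (R x)⟫ =
      ⟪v x, gradient (θ ∘ ⇑R.toContinuousLinearEquiv) x⟫ := by
    intro x
    have hg := gradient_comp_linearIsometryEquiv_symm R.symm θ x
    simp only [LinearIsometryEquiv.symm_symm] at hg
    have he : (θ ∘ ⇑R.toContinuousLinearEquiv) = fun y => θ (R y) := rfl
    rw [he, hg, LinearIsometryEquiv.inner_map_eq_flip]
  simp_rw [h2]
  exact hv _ hθ'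

/-- The slab `I × E` is invariant under `(t, y) ↦ (t, R⁻¹ y)`, as a measure-preserving map of the
restricted Lebesgue measures. [folklore] -/
theorem measurePreserving_prodMap_linearIsometryEquiv_slab (R : E ≃ₗᵢ[ℝ] E) (I : Set ℝ)
    (hI : MeasurableSet I) :
    MeasurePreserving (Prod.map (id : ℝ → ℝ) (R : E → E))
      ((volume : Measure (ℝ × E)).restrict (I ×ˢ univ))
      ((volume : Measure (ℝ × E)).restrict (I ×ˢ univ)) := by
  have he : MeasurePreserving (Prod.map (id : ℝ → ℝ) (R : E → E))
      (volume : Measure (ℝ × E)) volume := by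
    have := (MeasurePreserving.id (volume : Measure ℝ)).prod R.measurePreserving
    rwa [← Measure.volume_eq_prod] at this
  have hpre : (Prod.map (id : ℝ → ℝ) (R : E → E)) ⁻¹' (I ×ˢ (univ : Set E)) = I ×ˢ univ := by
    ext p
    simp
  have he' := he.restrict_preimage (hI.prod MeasurableSet.univ)
  rwa [hpre] at he'

omit [FiniteDimensional ℝ E] [MeasurableSpace E] [BorelSpace E] in
/-- **Conjugation of space–time test fields by a linear isometry.** If `ψ` is a space–time test
field on the slab `I × E`, so is `(t, y) ↦ L (ψ t (R y))` for a linear isometry `R` of `E` and a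
continuous linear map `L`. [folklore] -/
theorem IsSpaceTimeTestOn.comp_linearIsometryEquiv {F G : Type*} [NormedAddCommGroup F]
    [NormedSpace ℝ F] [NormedAddCommGroup G] [NormedSpace ℝ G] {I : Set ℝ} {hI : IsOpen I}
    {ψ : ℝ → E → F} (hψ : IsSpaceTimeTestOn (slab E I hI) ψ) (R : E ≃ₗᵢ[ℝ] E) (L : F →L[ℝ] G) :
    IsSpaceTimeTestOn (slab E I hI) (fun t y => L (ψ t (R y))) := by
  set Φ : (ℝ × E) ≃L[ℝ] (ℝ × E) :=
    (ContinuousLinearEquiv.refl ℝ ℝ).prodCongr R.toContinuousLinearEquiv with hΦ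
  have heq : uncurry (fun t y => L (ψ t (R y))) = L ∘ uncurry ψ ∘ Φ := by
    funext q; obtain ⟨t, y⟩ := q; rfl
  refine ⟨?_, ?_, ?_⟩
  · rw [heq]; exact L.contDiff.comp (hψ.contDiff.comp Φ.contDiff)
  · rw [heq]
    exact (hψ.hasCompactSupport.comp_homeomorph Φ.toHomeomorph).comp_left (map_zero L)
  · rw [heq]
    refine (tsupport_comp_subset (map_zero L) _).trans ?_
    rw [show (uncurry ψ ∘ ⇑Φ) = uncurry ψ ∘ ⇑Φ.toHomeomorph from rfl, tsupport_comp_eq_preimage]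
    intro q hq
    have h1 : Φ.toHomeomorph q ∈ (slab E I hI : Set (ℝ × E)) := hψ.tsupport_subset hq
    rw [SetLike.mem_coe, mem_slab] at h1 ⊢
    simpa [hΦ] using h1

/-- **Bounded weak Navier–Stokes solutions are invariant under linear isometries** (KNSS 2009,
§4 (ii): the class of bounded weak solutions; Majda–Bertozzi, Prop. 1.1 (iii), rotation symmetry
`v_Q(x, t) = Qᵗ v(Qx, t)`, here for KNSS's weak class). If `u` is a bounded weak solution on
`ℝⁿ × I` with viscosity `ν` and `R` is a linear isometry of `ℝⁿ`, then `(t, y) ↦ R (u t (R⁻¹ y))`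
is a bounded weak solution on `ℝⁿ × I`: measurability and the bound move along the
measure-preserving `(t, y) ↦ (t, R⁻¹ y)`; the divergence constraint is
`IsWeaklyDivFree.conj_linearIsometryEquiv`; and a divergence-free test field `ψ` is tested
against the conjugate by testing `R⁻¹ ψ(t, R ·)` against `u`, the three pairings matching point by
point (`convect_conj_linearIsometryEquiv`, `laplacian_conj_linearIsometryEquiv`) and the space
integral being invariant under `R`. [cite: MajdaBertozziCUP2002, §1.2 Prop. 1.1 (iii)] -/
theorem IsBoundedWeakNSSolutionOn.conj_linearIsometryEquiv {I : Set ℝ} {hI : IsOpen I} {ν : ℝ}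
    {u : ℝ → E → E} (h : IsBoundedWeakNSSolutionOn I hI ν u) (R : E ≃ₗᵢ[ℝ] E) :
    IsBoundedWeakNSSolutionOn I hI ν (fun t y => R (u t (R.symm y))) := by
  obtain ⟨hmeas, ⟨C, hC⟩, hdiv, hweak⟩ := h
  refine ⟨?_, ⟨C, fun t ht y => by rw [LinearIsometryEquiv.norm_map]; exact hC t ht _⟩, ?_,
    fun ψ hψ hψdiv => ?_⟩
  · -- measurability on the slab
    have heq : uncurry (fun t y => R (u t (R.symm y))) =
        R ∘ uncurry u ∘ Prod.map id (R.symm : E → E) := by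
      funext q; obtain ⟨t, y⟩ := q; rfl
    rw [heq]
    exact R.continuous.comp_aestronglyMeasurable (hmeas.comp_measurePreserving
      (measurePreserving_prodMap_linearIsometryEquiv_slab R.symm I hI.measurableSet))
  · -- divergence constraint
    filter_upwards [hdiv] with t ht
    exact ht.conj_linearIsometryEquiv R
  · -- the weak identity: test `R⁻¹ ψ(t, R ·)` against `u`
    set φ : ℝ → E → E := fun t x => R.symm (ψ t (R x)) with hφdef
    have hφ : IsSpaceTimeTestOn (slab E I hI) φ :=
      hψ.comp_linearIsometryEquiv R (R.symm : E →L[ℝ] E)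
    have hφ' : ∀ t x, φ t x = R.symm (ψ t (R.symm.symm x)) := fun t x => by
      simp [hφdef]
    have hφdiv : ∀ t, VectorCalculus.IsDivFree (φ t) := by
      intro t
      have h1 := (hψdiv t).conj_linearIsometryEquiv R.symm
      simp only [LinearIsometryEquiv.symm_symm] at h1
      exact h1
    have key := hweak φ hφ hφdiv
    -- pointwise identities at `x`, relating `φ` at `x` to `ψ` at `R x`
    have htd : ∀ t x, timeDeriv φ t x = R.symm (timeDeriv ψ t (R x)) := by
      intro t x
      rw [timeDeriv, timeDeriv]
      exact ((R.symm : E →L[ℝ] E).hasFDerivAt.comp_hasDerivAt t (hψ.hasDerivAt_time t (R x))).deriv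
    have hcv : ∀ t x, convect (u t) (φ t) x =
        R.symm (convect (fun y => R (u t (R.symm y))) (ψ t) (R x)) := by
      intro t x
      have h1 := convect_conj_linearIsometryEquiv R.symm (fun y => R (u t (R.symm y))) (ψ t) x
      simp only [LinearIsometryEquiv.symm_symm, LinearIsometryEquiv.symm_apply_apply] at h1
      rw [← h1]
    have hlap : ∀ t x, (Δ (φ t)) x = R.symm ((Δ (ψ t)) (R x)) := by
      intro t x
      have h1 := laplacian_conj_linearIsometryEquiv R.symm (ψ t) x
      simp only [LinearIsometryEquiv.symm_symm] at h1
      rw [← h1]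
    have hR : MeasurePreserving (R : E → E) volume volume := R.measurePreserving
    have hG : ∀ t, (∫ y, (⟪R (u t (R.symm y)), timeDeriv ψ t y⟫ +
        ⟪R (u t (R.symm y)), convect (fun y => R (u t (R.symm y))) (ψ t) y⟫ +
        ν * ⟪R (u t (R.symm y)), Δ (ψ t) y⟫)) =
        ∫ x, (⟪u t x, timeDeriv φ t x⟫ + ⟪u t x, convect (u t) (φ t) x⟫ +
          ν * ⟪u t x, Δ (φ t) x⟫) := by
      intro t
      rw [← hR.integral_comp R.toHomeomorph.measurableEmbedding]
      refine integral_congr_ae (Eventually.of_forall fun x => ?_)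
      simp only [LinearIsometryEquiv.symm_apply_apply, htd, hcv, hlap,
        LinearIsometryEquiv.inner_map_eq_flip]
    calc ∫ t in I, ∫ y, (⟪R (u t (R.symm y)), timeDeriv ψ t y⟫ +
          ⟪R (u t (R.symm y)), convect (fun y => R (u t (R.symm y))) (ψ t) y⟫ +
          ν * ⟪R (u t (R.symm y)), Δ (ψ t) y⟫)
        = ∫ t in I, ∫ x, (⟪u t x, timeDeriv φ t x⟫ + ⟪u t x, convect (u t) (φ t) x⟫ +
            ν * ⟪u t x, Δ (φ t) x⟫) := setIntegral_congr_fun hI.measurableSet fun t _ => hG t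
      _ = 0 := key

end Isometry

end Literature.Analysis.FluidPDE

end
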